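import Mathlib
import Summits.Ventures.DiscreteObjects.Mahler.TaylorJetProduct
import Summits.Ventures.DiscreteObjects.Mahler.NonreciprocalMeasureBound

/-!
# Schwarz–Pick inequalities for the first Taylor coefficients of a Schur function
(venture `DiscreteObjects`, target L)

Cell `pub-namedobj`, seat `pub-namedobj-mahler` (gen 8). Framing: lottery ticket; floor = certified
bounds/negative ranges.

For `F` holomorphic on the open unit disc with `‖F‖ ≤ 1` there (`IsSchur F`) and Taylor coefficients
`cₙ = jetCoeff F n` ([McKee–Smyth, *Around the Unit Circle*, Prop. 12.11 (b)–(d)], the coefficient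
inequalities used in Smyth's proof that nonreciprocal integer polynomials have `M ≥ θ₀`):

* `IsSchur.norm_jetCoeff_le` — `‖c_k‖ ≤ 1 - ‖c₀‖²` for every `k ≥ 1` (Prop. 12.11(b); from the flat
  case `SchwarzPickCoeff.norm_coeff_le_one_sub_norm_sq` of gen 7 by rotation averaging);
* `norm_le_one_on_ball_of_eq_pow_mul` — the order-`k` Schwarz lemma on the whole disc;
* `IsSchur.norm_jetCoeff_two_mul_le` — Prop. 12.11(c):
  `‖c_{2k} + c̄₀ c_k² /(1-‖c₀‖²)‖ ≤ 1 - ‖c₀‖² - ‖c_k‖²/(1-‖c₀‖²)` (`‖c₀‖ < 1`);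
* `IsSchur.jetCoeff_two_mul_le_real`, `IsSchur.real_le_jetCoeff_two_mul` — Prop. 12.11(d) for real
  coefficients: `-(1-c₀²) + c_k²/(1+c₀) ≤ c_{2k} ≤ 1 - c₀² - c_k²/(1-c₀)`.
-/

namespace Summit.Ventures.DiscreteObjects.Mahler

open Polynomial Metric Set Filter Topology Asymptotics Finset
open scoped ComplexConjugate

noncomputable section

/-- A **Schur function**: holomorphic on the open unit disc and bounded by `1` there. -/
structure IsSchur (F : ℂ → ℂ) : Prop where
  differentiableOn : DifferentiableOn ℂ F (ball 0 1)
  norm_le : ∀ z ∈ ball (0 : ℂ) 1, ‖F z‖ ≤ 1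

namespace IsSchur

variable {F : ℂ → ℂ}

/-- `‖c₀‖ ≤ 1`. -/
theorem norm_jetCoeff_zero_le (hF : IsSchur F) : ‖jetCoeff F 0‖ ≤ 1 :=
  hF.norm_le 0 (mem_ball_self one_pos)

/-- `-F` is Schur. -/
theorem neg (hF : IsSchur F) : IsSchur (fun z => -F z) :=
  ⟨hF.differentiableOn.neg, fun z hz => by rw [norm_neg]; exact hF.norm_le z hz⟩

/-- The rotation average of a Schur function is Schur. -/
theorem rotAvg (hF : IsSchur F) {k : ℕ} (hk : 1 ≤ k) {ω : ℂ} (hω : ‖ω‖ = 1) :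
    IsSchur (fun z => (k : ℂ)⁻¹ * ∑ j ∈ Finset.range k, F (ω ^ j * z)) :=
  ⟨differentiableOn_rotAvg k hω hF.differentiableOn,
    fun _ hz => norm_rotAvg_le_one hk hω hF.norm_le hz⟩

/-- Tails `jetTail F n` of a Schur function are holomorphic on the disc. -/
theorem differentiableOn_jetTail (hF : IsSchur F) (n : ℕ) :
    DifferentiableOn ℂ (jetTail F n) (ball 0 1) :=
  Summit.Ventures.DiscreteObjects.Mahler.differentiableOn_jetTail one_pos hF.differentiableOn n

end IsSchur

/-- A primitive `k`-th root of unity in `ℂ` (`k ≥ 1`). -/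
theorem exists_isPrimitiveRoot {k : ℕ} (hk : 1 ≤ k) : ∃ ω : ℂ, IsPrimitiveRoot ω k :=
  ⟨_, Complex.isPrimitiveRoot_exp k (by omega)⟩

/-- **Prop. 12.11(b)**: `‖c_k‖ ≤ 1 - ‖c₀‖²` for a Schur function and `k ≥ 1`. -/
theorem IsSchur.norm_jetCoeff_le {F : ℂ → ℂ} (hF : IsSchur F) {k : ℕ} (hk : 1 ≤ k) :
    ‖jetCoeff F k‖ ≤ 1 - ‖jetCoeff F 0‖ ^ 2 := by
  obtain ⟨ω, hω⟩ := exists_isPrimitiveRoot hk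
  have hω1 : ‖ω‖ = 1 := hω.norm'_eq_one (by omega)
  set Φ : ℂ → ℂ := fun z => (k : ℂ)⁻¹ * ∑ j ∈ Finset.range k, F (ω ^ j * z) with hΦdef
  have hΦ : IsSchur Φ := hF.rotAvg hk hω1
  have hcoef : ∀ n, jetCoeff Φ n = if k ∣ n then jetCoeff F n else 0 :=
    fun n => jetCoeff_rotAvg one_pos hF.differentiableOn hk hω n
  have h0 : jetCoeff Φ 0 = jetCoeff F 0 := by rw [hcoef]; simp
  have hkk : jetCoeff Φ k = jetCoeff F k := by rw [hcoef]; simp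
  have hflat : ∀ n, 0 < n → n < k → jetCoeff Φ n = 0 := by
    intro n hn0 hnk
    rw [hcoef, if_neg (Nat.not_dvd_of_pos_of_lt hn0 hnk)]
  have hrep : ∀ z ∈ ball (0 : ℂ) 1, Φ z = jetCoeff F 0 + z ^ k * jetTail Φ k z := by
    intro z _; rw [← h0]; exact eq_jetCoeff_zero_add_pow_mul Φ hk hflat z
  have h := norm_coeff_le_one_sub_norm_sq hk (hΦ.differentiableOn_jetTail k) hΦ.norm_le hrep
  rwa [jetTail_apply_zero, hkk] at h

/-- **Order-`k` Schwarz lemma on the whole disc.** If `Θ` maps the open unit disc into the closed unit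
disc and `Θ z = z^k Ψ z` there with `Ψ` holomorphic and `k ≥ 1`, then `‖Ψ z‖ ≤ 1` on the disc. -/
theorem norm_le_one_on_ball_of_eq_pow_mul {Θ Ψ : ℂ → ℂ} {k : ℕ} (hk : 1 ≤ k)
    (hΨ : DifferentiableOn ℂ Ψ (ball 0 1)) (hbd : ∀ z ∈ ball (0 : ℂ) 1, ‖Θ z‖ ≤ 1)
    (hrep : ∀ z ∈ ball (0 : ℂ) 1, Θ z = z ^ k * Ψ z) : ∀ z ∈ ball (0 : ℂ) 1, ‖Ψ z‖ ≤ 1 := by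
  intro z hz
  by_cases hz0 : z = 0
  · subst hz0; exact norm_le_one_of_eq_pow_mul hk hΨ hbd hrep
  have hball : ball (0 : ℂ) 1 ∈ 𝓝 (0 : ℂ) := ball_mem_nhds _ one_pos
  have hΘd : DifferentiableOn ℂ Θ (ball 0 1) := by
    have h1 : DifferentiableOn ℂ (fun z : ℂ => z ^ k * Ψ z) (ball 0 1) :=
      (differentiableOn_id.pow k).mul hΨ
    exact h1.congr hrep
  have hΘ0 : Θ 0 = 0 := by
    rw [hrep 0 (mem_ball_self one_pos)]; simp [zero_pow (by omega : k ≠ 0)]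
  have hmaps : MapsTo Θ (ball (0 : ℂ) 1) (closedBall (Θ 0) 1) := by
    intro w hw
    rw [hΘ0, mem_closedBall, dist_zero_right]
    exact hbd w hw
  have hcontΨ : ContinuousAt Ψ 0 := (hΨ.differentiableAt hball).continuousAt
  have hlit : (fun w => Θ w - Θ 0) =o[𝓝 (0 : ℂ)] fun w => ‖w - 0‖ ^ (k - 1) := by
    have hev : (fun w => Θ w - Θ 0) =ᶠ[𝓝 (0 : ℂ)] fun w => w ^ (k - 1) * (w * Ψ w) := by
      filter_upwards [hball] with w hw
      rw [hΘ0, sub_zero, hrep w hw, ← mul_assoc, ← pow_succ, Nat.sub_add_cancel hk]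
    refine Asymptotics.IsLittleO.congr' ?_ hev.symm EventuallyEq.rfl
    have h1 : (fun w : ℂ => w ^ (k - 1)) =O[𝓝 (0 : ℂ)] fun w => ‖w - 0‖ ^ (k - 1) := by
      apply Asymptotics.IsBigO.of_bound 1
      filter_upwards with w
      simp
    have h2 : (fun w : ℂ => w * Ψ w) =o[𝓝 (0 : ℂ)] fun _ => (1 : ℝ) := by
      rw [Asymptotics.isLittleO_one_iff]
      have : Tendsto (fun w : ℂ => w * Ψ w) (𝓝 0) (𝓝 (0 * Ψ 0)) :=
        (continuous_id.tendsto 0).mul hcontΨ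
      simpa using this
    simpa using h1.mul_isLittleO h2
  have h := Complex.dist_le_mul_div_pow_of_mapsTo_ball_of_isLittleO hΘd hmaps hlit hz
  rw [Nat.sub_add_cancel hk, hΘ0, dist_zero_right, dist_zero_right, div_one, one_mul,
    hrep z hz, norm_mul, norm_pow] at h
  have hpos : 0 < ‖z‖ ^ k := pow_pos (norm_pos_iff.mpr hz0) k
  by_contra hgt
  push Not at hgt
  have : ‖z‖ ^ k * 1 < ‖z‖ ^ k * ‖Ψ z‖ := mul_lt_mul_of_pos_left hgt hpos
  linarith

/-- Sums over `antidiagonal n` with a single surviving term `(n, 0)`. -/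
theorem sum_antidiagonal_eq_fst {G D : ℕ → ℂ} (n : ℕ)
    (h : ∀ i j, i + j = n → 0 < j → G i * D j = 0) :
    ∑ ij ∈ antidiagonal n, G ij.1 * D ij.2 = G n * D 0 := by
  rw [Finset.sum_eq_single_of_mem (n, 0) (by simp)]
  intro ij hij hne
  have hsum : ij.1 + ij.2 = n := by simpa using hij
  rcases Nat.eq_zero_or_pos ij.2 with h0 | hpos
  · exfalso; apply hne
    ext
    · simp; omega
    · simp; omega
  · exact h ij.1 ij.2 hsum hpos

/-- **Prop. 12.11(c).**  For a Schur function with `‖c₀‖ < 1` and `k ≥ 1`: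
`‖c_{2k} + c̄₀ c_k²/(1-‖c₀‖²)‖ ≤ 1 - ‖c₀‖² - ‖c_k‖²/(1-‖c₀‖²)`. -/
theorem IsSchur.norm_jetCoeff_two_mul_le {F : ℂ → ℂ} (hF : IsSchur F) {k : ℕ} (hk : 1 ≤ k)
    (h0 : ‖jetCoeff F 0‖ < 1) :
    ‖jetCoeff F (2 * k) + conj (jetCoeff F 0) * jetCoeff F k ^ 2 / (1 - ‖jetCoeff F 0‖ ^ 2)‖ ≤
      1 - ‖jetCoeff F 0‖ ^ 2 - ‖jetCoeff F k‖ ^ 2 / (1 - ‖jetCoeff F 0‖ ^ 2) := by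
  obtain ⟨ω, hω⟩ := exists_isPrimitiveRoot hk
  have hω1 : ‖ω‖ = 1 := hω.norm'_eq_one (by omega)
  have hball : ball (0 : ℂ) 1 ∈ 𝓝 (0 : ℂ) := ball_mem_nhds _ one_pos
  -- the flat rotation average `Φ` with the same coefficients `c₀, c_k, c_{2k}`
  set Φ : ℂ → ℂ := fun z => (k : ℂ)⁻¹ * ∑ j ∈ Finset.range k, F (ω ^ j * z) with hΦdef
  have hΦ : IsSchur Φ := hF.rotAvg hk hω1
  have hcoef : ∀ n, jetCoeff Φ n = if k ∣ n then jetCoeff F n else 0 :=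
    fun n => jetCoeff_rotAvg one_pos hF.differentiableOn hk hω n
  set a : ℂ := jetCoeff F 0 with ha
  set ck : ℂ := jetCoeff F k with hck
  set c2k : ℂ := jetCoeff F (2 * k) with hc2k
  have hΦ0 : jetCoeff Φ 0 = a := by rw [hcoef]; simp [ha]
  have hΦk : jetCoeff Φ k = ck := by rw [hcoef]; simp [hck]
  have hΦ2k : jetCoeff Φ (2 * k) = c2k := by rw [hcoef]; simp [hc2k]
  have hΦoff : ∀ n, ¬ k ∣ n → jetCoeff Φ n = 0 := fun n hn => by rw [hcoef, if_neg hn]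
  have hΦval : Φ 0 = a := by have h := hΦ0; rwa [jetCoeff_zero] at h
  -- the real quantity `D = 1 - ‖a‖²`
  set D : ℝ := 1 - ‖a‖ ^ 2 with hD
  have hDpos : 0 < D := by rw [hD]; nlinarith [norm_nonneg a]
  have hDC : (1 : ℂ) - conj a * a = (D : ℂ) := by
    rw [hD, Complex.conj_mul' a]; push_cast; ring
  -- the Möbius transform `G = (Φ - a)/(1 - ā Φ)` and its denominator `Dn`
  set Dn : ℂ → ℂ := fun z => 1 - conj a * Φ z with hDn
  have hDn_ne : ∀ z ∈ ball (0 : ℂ) 1, Dn z ≠ 0 := by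
    intro z hz
    have h1 : ‖conj a * Φ z‖ < 1 := by
      rw [norm_mul, Complex.norm_conj]
      calc ‖a‖ * ‖Φ z‖ ≤ ‖a‖ * 1 := by gcongr; exact hΦ.norm_le z hz
        _ < 1 := by rw [mul_one]; exact h0
    intro h
    have : conj a * Φ z = 1 := by rw [hDn] at h; exact (sub_eq_zero.mp h).symm
    rw [this, norm_one] at h1
    exact lt_irrefl _ h1
  have hDnd : DifferentiableOn ℂ Dn (ball 0 1) :=
    (hΦ.differentiableOn.const_mul (conj a)).const_sub (1 : ℂ)
  set G : ℂ → ℂ := fun z => (Φ z - a) / Dn z with hG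
  have hGd : DifferentiableOn ℂ G (ball 0 1) := (hΦ.differentiableOn.sub_const a).div hDnd hDn_ne
  have hGb : ∀ z ∈ ball (0 : ℂ) 1, ‖G z‖ ≤ 1 :=
    fun z hz => norm_moebius_le_one h0 (hΦ.norm_le z hz)
  have hGS : IsSchur G := ⟨hGd, hGb⟩
  -- coefficients of `Dn` and of `Φ - a`
  have hDn0 : jetCoeff Dn 0 = (D : ℂ) := by
    rw [jetCoeff_zero, hDn]; simp only; rw [hΦval, hDC]
  have hDnS : ∀ n, 0 < n → jetCoeff Dn n = -(conj a * jetCoeff Φ n) := by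
    intro n hn
    have h1 := jetCoeff_sub one_pos (differentiableOn_const (1 : ℂ))
      (hΦ.differentiableOn.const_mul (conj a)) n
    have h2 := jetCoeff_const_mul one_pos hΦ.differentiableOn (conj a) n
    have h3 := jetCoeff_const (1 : ℂ) n
    rw [if_neg (by omega)] at h3
    have : jetCoeff Dn n = jetCoeff (fun z => (fun _ : ℂ => (1 : ℂ)) z - (fun w => conj a * Φ w) z) n := rfl
    rw [this, h1, h2, h3, zero_sub]
  have hΦa : ∀ n, jetCoeff (fun z => Φ z - a) n = jetCoeff Φ n - if n = 0 then a else 0 := by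
    intro n
    have h1 := jetCoeff_sub one_pos hΦ.differentiableOn (differentiableOn_const a) n
    rw [jetCoeff_const] at h1
    exact h1
  -- the identity `G · Dn = Φ - a` on the disc and the resulting convolution relations
  have hGDn : ∀ n, jetCoeff (fun z => Φ z - a) n =
      ∑ ij ∈ antidiagonal n, jetCoeff G ij.1 * jetCoeff Dn ij.2 := by
    intro n
    rw [← jetCoeff_mul one_pos hGd hDnd n]
    apply jetCoeff_congr one_pos (hGd.mul hDnd)
    intro z hz
    show Φ z - a = G z * Dn z
    rw [hG]; simp only; field_simp [hDn_ne z hz]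
  have hG0 : jetCoeff G 0 = 0 := by
    rw [jetCoeff_zero, hG]; simp only; rw [hΦval, sub_self, zero_div]
  -- `Dn_j = 0` for `0 < j`, `k ∤ j`
  have hDn_off : ∀ j, 0 < j → ¬ k ∣ j → jetCoeff Dn j = 0 := by
    intro j hj hkj; rw [hDnS j hj, hΦoff j hkj, mul_zero, neg_zero]
  -- `G_n = 0` for `n < k`
  have hGflat : ∀ n, n < k → jetCoeff G n = 0 := by
    intro n hnk
    rcases Nat.eq_zero_or_pos n with rfl | hn0
    · exact hG0
    have h := hGDn n
    rw [sum_antidiagonal_eq_fst n (fun i j hij hj =>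
      by rw [hDn_off j hj (Nat.not_dvd_of_pos_of_lt hj (by omega)), mul_zero]), hDn0,
      hΦa, if_neg (by omega), sub_zero, hΦoff n (Nat.not_dvd_of_pos_of_lt hn0 hnk)] at h
    have hD0 : (D : ℂ) ≠ 0 := by exact_mod_cast hDpos.ne'
    exact (mul_eq_zero.mp h.symm).resolve_right hD0
  -- `G_k · D = c_k`
  have hGk : jetCoeff G k * (D : ℂ) = ck := by
    have h := hGDn k
    rw [sum_antidiagonal_eq_fst k (fun i j hij hj => by
      rcases eq_or_ne j k with rfl | hjk
      · rw [show i = 0 by omega, hG0, zero_mul]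
      · rw [hDn_off j hj (fun hd => hjk (Nat.eq_of_dvd_of_lt_two_mul (by omega) hd (by omega))),
          mul_zero]), hDn0, hΦa, if_neg (by omega), sub_zero, hΦk] at h
    exact h.symm
  -- `G_{2k} · D - ā c_k G_k = c_{2k}`
  have hG2k : jetCoeff G (2 * k) * (D : ℂ) - conj a * ck * jetCoeff G k = c2k := by
    have h := hGDn (2 * k)
    rw [Finset.sum_eq_add_of_mem (2 * k, 0) (k, k) (by simp) (by simp [two_mul])
      (by intro e; have := (Prod.ext_iff.mp e).2; simp at this; omega) ?rest] at h
    · rw [hDn0, hDnS k (by omega), hΦk, hΦa, if_neg (by omega), sub_zero, hΦ2k] at h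
      linear_combination -h
    · intro ij hij hne
      have hsum : ij.1 + ij.2 = 2 * k := by simpa using hij
      rcases Nat.eq_zero_or_pos ij.2 with hj0 | hjpos
      · exfalso; apply hne.1; ext <;> simp <;> omega
      rcases eq_or_ne ij.2 k with hjk | hjk
      · exfalso; apply hne.2; ext <;> simp <;> omega
      rcases eq_or_ne ij.2 (2 * k) with hj2 | hj2
      · rw [show ij.1 = 0 by omega, hG0, zero_mul]
      · rw [hDn_off ij.2 hjpos ?_, mul_zero]
        intro hd
        obtain ⟨m, hm⟩ := hd
        have : m < 2 := by
          by_contra hm2; push Not at hm2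
          have : k * m ≥ k * 2 := Nat.mul_le_mul_left k hm2
          omega
        interval_cases m <;> omega
  -- `G = z^k Ψ` with `Ψ` Schur
  set Ψ := jetTail G k with hΨ
  have hGrep : ∀ z ∈ ball (0 : ℂ) 1, G z = z ^ k * Ψ z := by
    intro z _
    have := eq_jetCoeff_zero_add_pow_mul G hk (fun n hn0 hnk => hGflat n hnk) z
    rw [this, hG0, zero_add]
  have hΨd : DifferentiableOn ℂ Ψ (ball 0 1) := hGS.differentiableOn_jetTail k
  have hΨS : IsSchur Ψ := ⟨hΨd, norm_le_one_on_ball_of_eq_pow_mul hk hΨd hGb hGrep⟩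
  have hineq := hΨS.norm_jetCoeff_le hk
  rw [hΨ, jetCoeff_jetTail, jetCoeff_jetTail, add_zero, ← two_mul] at hineq
  -- final algebra
  set X := jetCoeff G (2 * k) with hX
  set Y := jetCoeff G k with hY
  have hD0 : (D : ℂ) ≠ 0 := by exact_mod_cast hDpos.ne'
  have hDC' : (1 : ℂ) - ((‖a‖ : ℝ) : ℂ) ^ 2 = (D : ℂ) := by rw [hD]; push_cast; ring
  have hYeq : Y = ck / (D : ℂ) := by rw [← hGk]; field_simp
  have hXeq : c2k + conj a * ck ^ 2 / (D : ℂ) = X * (D : ℂ) := by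
    rw [← hG2k, hYeq]; field_simp; ring
  have hnormY : ‖Y‖ = ‖ck‖ / D := by
    rw [hYeq, norm_div, Complex.norm_real, Real.norm_eq_abs, abs_of_pos hDpos]
  have hnormD : ‖(D : ℂ)‖ = D := by rw [Complex.norm_real, Real.norm_eq_abs, abs_of_pos hDpos]
  rw [show (1 : ℂ) - (‖a‖ : ℂ) ^ 2 = (D : ℂ) from hDC', hXeq, norm_mul, hnormD]
  rw [hnormY] at hineq
  have : ‖ck‖ ^ 2 / D = D * (‖ck‖ / D) ^ 2 := by field_simp
  rw [this]
  have h2 := mul_le_mul_of_nonneg_right hineq hDpos.le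
  nlinarith [h2]

/-- **Prop. 12.11(d)** (real coefficients): if `c₀ = a`, `c_k = u`, `c_{2k} = v` are real, `|a| < 1`,
then `v ≤ 1 - a² - u²/(1-a)` and `-(1-a²) + u²/(1+a) ≤ v`. -/
theorem IsSchur.jetCoeff_two_mul_real_bounds {F : ℂ → ℂ} (hF : IsSchur F) {k : ℕ} (hk : 1 ≤ k)
    {a u v : ℝ} (ha : jetCoeff F 0 = a) (hu : jetCoeff F k = u) (hv : jetCoeff F (2 * k) = v)
    (ha1 : |a| < 1) :
    v ≤ 1 - a ^ 2 - u ^ 2 / (1 - a) ∧ -(1 - a ^ 2) + u ^ 2 / (1 + a) ≤ v := by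
  have h0 : ‖jetCoeff F 0‖ < 1 := by rwa [ha, Complex.norm_real, Real.norm_eq_abs]
  have key := hF.norm_jetCoeff_two_mul_le hk h0
  rw [ha, hu, hv, Complex.norm_real, Complex.norm_real, Real.norm_eq_abs, Real.norm_eq_abs,
    sq_abs, sq_abs] at key
  have e : ((v : ℂ) + conj (a : ℂ) * (u : ℂ) ^ 2 / (1 - ((|a| : ℝ) : ℂ) ^ 2)) =
      ((v + a * u ^ 2 / (1 - a ^ 2) : ℝ) : ℂ) := by
    rw [Complex.conj_ofReal]
    have h2 : ((|a| : ℝ) : ℂ) ^ 2 = ((a ^ 2 : ℝ) : ℂ) := by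
      rw [← Complex.ofReal_pow, sq_abs]
    rw [h2]; push_cast; ring
  rw [e, Complex.norm_real, Real.norm_eq_abs] at key
  have ha' := abs_lt.mp ha1
  have h1a : 0 < 1 - a := by linarith
  have h1a' : 0 < 1 + a := by linarith
  have h1a2 : 1 - a ^ 2 = (1 - a) * (1 + a) := by ring
  obtain ⟨hlo, hhi⟩ := abs_le.mp key
  constructor
  · have : 1 - a ^ 2 - u ^ 2 / (1 - a ^ 2) - a * u ^ 2 / (1 - a ^ 2) = 1 - a ^ 2 - u ^ 2 / (1 - a) := by
      rw [h1a2]; field_simp; ring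
    linarith
  · have : -(1 - a ^ 2 - u ^ 2 / (1 - a ^ 2)) - a * u ^ 2 / (1 - a ^ 2) =
        -(1 - a ^ 2) + u ^ 2 / (1 + a) := by
      rw [h1a2]; field_simp; ring
    linarith

end

end Summit.Ventures.DiscreteObjects.Mahler
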